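import Literature.AnabelianGeometry.SemiGraphs.ArithDecompositionData
import Literature.AnabelianGeometry.SemiGraphs.TemperedGroups
import Mathlib.Topology.Ultrafilter
import HarnessLib

/-!
# Compactness in tempered groups: closed subsets with finite images are compact; compactness of
# the arithmetic decomposition groups `Π^temp_{𝔊,v}`, `Π^temp_{𝔊,b}` from the tower ([SemiAnbd] §5 p. 65)

Mochizuki, *Semi-graphs of anabelioids*, Publ. RIMS **42** (2006), §3 Def 3.1 (i) p. 33 (tempered
groups), §5 p. 65 / Rmk 5.3.1 (the decomposition groups `Π^temp_{𝔊,v} ⊆ Π^temp_𝔊` are compact —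
images of the profinite fundamental groups of the constituent anabelioids `𝔊_v`), Thm 5.4 p. 66,
kurims `paper:url-f33ace170ff4`; Bourbaki, *General Topology* Ch. II §4.2 (a uniform space is compact
iff it is complete and precompact). [cite: MochizukiSemiAnbd2006, Rmk 5.3.1, p. 65]

PROOF-ONLY file of sub-DAG `plan/L3/SUBDAG-SemiAnbd-Thm54.md`, producer row T54-B (GAP-LEDGER
G-w4d053-1), abc-iut-w4-d053 (T54-0 producer / packager).  It discharges the two LEVEL-B binders
`hVc : ∀ v, IsCompact (arithVertGp R ι v)` and `hBc : ∀ b, IsCompact (arithBrGp R ι b)` of the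
Thm 5.4 (i)∧(ii) umbrella `ProfiniteSemiGraph.arithMaximalCompactStatementI_and_II_ofChart`
(abc-iut-w4-d040, ArithThm54OfChart.lean) in TOWER CURRENCY — i.e. from inputs the tower half of
T54-B (abc-iut-L3-d4: arithmetic actions on the trees `𝒢_{∞,j}` extending the geometric ones) and
the topology half (abc-iut-L3-d2: `Π^temp_𝔊` tempered, ArithTemperedGroupTopology.lean) produce —
instead of the "compact arithmetically ample thickening `K`" of abc-iut-w4-d029's
`isCompact_commensurator_of_thickening` (ArithVerticialCompactAmple.lean), which in print is the image
of `π̂₁(𝔊_v)` and has no producer in the chart/tower model: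

* `IsTempered.isCompact_of_isClosed_of_finite_image` — in a tempered group `G` (Def 3.1 (i):
  `G = lim_N G/N` over its open normal subgroups, intrinsic form `IsTempered` of TemperedGroups.lean)
  a CLOSED subset `S` whose image in every countable discrete quotient `G/N` is FINITE is compact
  (Bourbaki: closed in complete ⇒ complete; precompact + complete ⇒ compact; here by ultrafilters:
  an ultrafilter on `S` picks one fibre of each `G → G/N`, these are compatible, `complete` gives a
  limit point, which lies in the closed `S`).
* `IsTempered.isCompact_of_isClosed_of_hasBasis` — the same with the finiteness asked only along a
  basis of neighbourhoods of `1` made of subgroups `W i` (e.g. abc-iut-L3-d2's basis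
  `K n ⊓ aug⁻¹ U` of `Π^temp_𝔊`): finite image in each `G / W i`.
* `isClosed_setOf_forall_vertexMap_eq` — the stabiliser `{g | ∀ j, g • x_j = x_j}` of a system of
  tree vertices under actions `act j : G →* Aut (T j)` with OPEN KERNELS is closed.
* `ProfiniteSemiGraph.isCompact_arithVertGp_of_forall_fixes` (`hVc`) — for the chart-produced data
  (`arithVertGp R ι v = C_{Π^temp_𝔊}(ι Π^temp_{𝔾,v})`, ArithDecompositionData.lean): IF the
  dictionary (AI1) of `ArithLevelData.fix` holds for it ("`g ∈ Π^temp_{𝔊,v}` iff `g` fixes the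
  pro-vertex `x̃_v = (x_j)_j`", abc-iut-w4-d059's `mem_arithVertGp_iff_fixes_of_edgeData`) and the
  image of `Π^temp_{𝔊,v}` in every `Π^temp_𝔊 / N` is finite (TOWER FACT: at each arithmetic level
  the vertex stabilisers of `Gal(𝔊_{∞,j}/𝔊)` acting on the tree `𝔊_{∞,j}` are finite — the free
  `π₁(𝔾_j)` acts freely, `Gal(𝔊_j/𝔊)` is finite), THEN `Π^temp_{𝔊,v}` is compact.
* `ProfiniteSemiGraph.isCompact_arithBrGp_of_isClosed` (`hBc`) — `Π^temp_{𝔊,b} ≤ Π^temp_{𝔊,v}` is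
  compact as soon as it is closed (e.g. a pair-stabiliser, abc-iut-w4-d059's
  `mem_arithBrGp_iff_fixes_pair`), `Π^temp_{𝔊,v}` being compact.
* `finite_image_quotient_inf`, `finite_image_quotient_comap` — bookkeeping: finite images modulo
  `A` and modulo `B` give a finite image modulo `A ⊓ B`, and images modulo `aug⁻¹ U` are finite
  when `[Π_A : U] < ∞` (so finiteness modulo abc-iut-L3-d2's basic subgroups `K n ⊓ aug⁻¹ U`
  follows from finiteness modulo the level kernels `K n` alone, `Π_A` being profinite).

Nothing here asserts a statement of [SemiAnbd] beyond what is proved; typed ≠ proved; no side taken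
on [IUTchIII] Cor 3.12.
-/

namespace Literature.AnabelianGeometry.SemiGraphs

open CategoryTheory Topology Filter
open scoped Pointwise

universe u u' u''

/-! ### Closed subsets of a tempered group with finite images are compact -/

section Tempered

variable {G : Type u} [Group G] [TopologicalSpace G] [IsTopologicalGroup G]

/-- **Compactness criterion in a tempered group** ([SemiAnbd] Def 3.1 (i) p. 33: `Π = lim_N Π/N`;
Bourbaki TG II §4.2: closed in complete is complete, complete and precompact is compact): a closed
subset `S ⊆ Π` whose image in `Π/N` is finite for every open normal subgroup `N` is compact.
Proof by ultrafilters: an ultrafilter containing `S` contains exactly one fibre of each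
`Π → Π/N`; these fibres form a compatible family of cosets, `IsTempered.complete` produces `g₀`
with `g₀ N` in the ultrafilter for all `N`, the `g₀ N` are a basis of neighbourhoods of `g₀`
(`IsTempered.basis`), so the ultrafilter converges to `g₀ ∈ S̄ = S`.
[cite: BourbakiGT1, Ch. II §4.2, Cor. to Th. 3] -/
theorem IsTempered.isCompact_of_isClosed_of_finite_image (hG : IsTempered G) {S : Set G}
    (hS : IsClosed S)
    (hfin : ∀ N : OpenNormalSubgroup G,
      ((QuotientGroup.mk : G → G ⧸ N.toSubgroup) '' S).Finite) :
    IsCompact S := by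
  classical
  rw [isCompact_iff_ultrafilter_le_nhds']
  intro F hSF
  -- for each `N`, one fibre of `G → G/N` lies in `F`
  have hfib : ∀ N : OpenNormalSubgroup G, ∃ q : G ⧸ N.toSubgroup,
      (QuotientGroup.mk : G → G ⧸ N.toSubgroup) ⁻¹' {q} ∈ F := by
    intro N
    have hcov : S ⊆ ⋃ q ∈ (QuotientGroup.mk : G → G ⧸ N.toSubgroup) '' S,
        (QuotientGroup.mk : G → G ⧸ N.toSubgroup) ⁻¹' {q} := by
      intro s hs
      exact Set.mem_biUnion (Set.mem_image_of_mem _ hs) rfl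
    obtain ⟨q, -, hq⟩ :=
      (Ultrafilter.finite_biUnion_mem_iff (hfin N)).1 (Filter.mem_of_superset hSF hcov)
    exact ⟨q, hq⟩
  choose x hx using hfib
  -- the chosen cosets are compatible
  have hcompat : ∀ N M : OpenNormalSubgroup G, N ≤ M → ∀ g : G,
      x N = (g : G ⧸ N.toSubgroup) → x M = (g : G ⧸ M.toSubgroup) := by
    intro N M hNM g hgN
    by_contra hne
    have h1 : (QuotientGroup.mk : G → G ⧸ N.toSubgroup) ⁻¹' {x N} ⊆
        (QuotientGroup.mk : G → G ⧸ M.toSubgroup) ⁻¹' {(g : G ⧸ M.toSubgroup)} := by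
      intro y hy
      simp only [Set.mem_preimage, Set.mem_singleton_iff] at hy ⊢
      rw [hgN, QuotientGroup.eq] at hy
      rw [QuotientGroup.eq]
      exact hNM hy
    have h2 : Disjoint ((QuotientGroup.mk : G → G ⧸ M.toSubgroup) ⁻¹' {(g : G ⧸ M.toSubgroup)})
        ((QuotientGroup.mk : G → G ⧸ M.toSubgroup) ⁻¹' {x M}) :=
      Disjoint.preimage _ (Set.disjoint_singleton.2 (Ne.symm hne))
    have hmem : (∅ : Set G) ∈ F := by
      rw [← Set.disjoint_iff_inter_eq_empty.1 h2]
      exact Filter.inter_mem (Filter.mem_of_superset (hx N) h1) (hx M)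
    exact (F : Filter G).empty_notMem hmem
  obtain ⟨g₀, hg₀⟩ := hG.complete x hcompat
  -- `F` converges to `g₀`
  have hle : (F : Filter G) ≤ 𝓝 g₀ := by
    intro U hU
    have hV : (fun y : G => g₀ * y) ⁻¹' U ∈ 𝓝 (1 : G) :=
      (continuous_const.mul continuous_id).continuousAt.preimage_mem_nhds (by simpa using hU)
    obtain ⟨N, -, hN⟩ := hG.basis _ hV
    refine Filter.mem_of_superset (hx N) ?_
    intro y hy
    simp only [Set.mem_preimage, Set.mem_singleton_iff, hg₀ N] at hy
    rw [QuotientGroup.eq] at hy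
    have hy' : g₀⁻¹ * y ∈ N.toSubgroup := by
      simpa only [mul_inv_rev, inv_inv] using N.toSubgroup.inv_mem hy
    have hyU : g₀⁻¹ * y ∈ (fun y : G => g₀ * y) ⁻¹' U := hN hy'
    simpa using hyU
  exact ⟨g₀, hS.closure_subset (mem_closure_iff_ultrafilter.2 ⟨F, hSF, hle⟩), hle⟩

/-- The criterion with finiteness asked only along a BASIS of neighbourhoods of `1` consisting of
subgroups `W i` (e.g. abc-iut-L3-d2's basis `K n ⊓ aug⁻¹ U` of `Π^temp_𝔊`,
`exists_isTempered_topology_of_kernelSeq`): a closed `S` with finite image in each `G / W i` is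
compact. [cite: BourbakiGT1, Ch. II §4.2, Cor. to Th. 3] -/
theorem IsTempered.isCompact_of_isClosed_of_hasBasis (hG : IsTempered G) {ι : Sort*}
    {p : ι → Prop} {W : ι → Subgroup G} (hW : (𝓝 (1 : G)).HasBasis p (fun i => (W i : Set G)))
    {S : Set G} (hS : IsClosed S)
    (hfin : ∀ i, p i → ((QuotientGroup.mk : G → G ⧸ W i) '' S).Finite) :
    IsCompact S := by
  refine hG.isCompact_of_isClosed_of_finite_image hS fun N => ?_
  obtain ⟨i, hpi, hiN⟩ := hW.mem_iff.1 (N.toOpenSubgroup.mem_nhds_one)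
  have hle : W i ≤ N.toSubgroup := fun g hg => hiN hg
  have himage : (QuotientGroup.mk : G → G ⧸ N.toSubgroup) '' S =
      Subgroup.quotientMapOfLE hle '' ((QuotientGroup.mk : G → G ⧸ W i) '' S) := by
    rw [Set.image_image]
    rfl
  rw [himage]
  exact (hfin i hpi).image _

omit [TopologicalSpace G] [IsTopologicalGroup G] in
/-- Bookkeeping for the product bases of [SemiAnbd] p. 65's `Π^temp_𝔊` (abc-iut-L3-d2's
`K n ⊓ aug⁻¹ U`): if the images of `S` modulo `A` and modulo `B` are finite, so is its image modulo
`A ⊓ B` (the map `G/(A ⊓ B) → G/A × G/B` is injective); with `A = K n` a level kernel and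
`B = aug⁻¹ U`, `[Π_A : U] < ∞`, this feeds `IsTempered.isCompact_of_isClosed_of_hasBasis`.
[cite: MochizukiSemiAnbd2006, Rmk 5.3.1, p. 65] -/
theorem finite_image_quotient_inf {S : Set G} {A B : Subgroup G}
    (hA : ((QuotientGroup.mk : G → G ⧸ A) '' S).Finite)
    (hB : ((QuotientGroup.mk : G → G ⧸ B) '' S).Finite) :
    ((QuotientGroup.mk : G → G ⧸ (A ⊓ B)) '' S).Finite := by
  classical
  let f : G ⧸ (A ⊓ B) → (G ⧸ A) × (G ⧸ B) := fun q =>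
    (Subgroup.quotientMapOfLE (inf_le_left : A ⊓ B ≤ A) q,
      Subgroup.quotientMapOfLE (inf_le_right : A ⊓ B ≤ B) q)
  have hf : Function.Injective f := by
    rintro ⟨a⟩ ⟨b⟩ h
    have h1 : (QuotientGroup.mk a : G ⧸ A) = QuotientGroup.mk b := congrArg Prod.fst h
    have h2 : (QuotientGroup.mk a : G ⧸ B) = QuotientGroup.mk b := congrArg Prod.snd h
    change (QuotientGroup.mk a : G ⧸ (A ⊓ B)) = QuotientGroup.mk b
    rw [QuotientGroup.eq] at h1 h2 ⊢
    exact ⟨h1, h2⟩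
  refine Set.Finite.of_finite_image ?_ hf.injOn
  refine ((hA.prod hB).subset ?_)
  rintro _ ⟨_, ⟨s, hs, rfl⟩, rfl⟩
  exact ⟨⟨s, hs, rfl⟩, ⟨s, hs, rfl⟩⟩

omit [TopologicalSpace G] [IsTopologicalGroup G] in
/-- The preimage of a finite-index situation: if `aug : G →* P` and `U ≤ P` has finite index
(e.g. `U` open in the compact `Π_A`), the image of ANY `S ⊆ G` modulo `aug⁻¹ U` is finite.
[cite: MochizukiSemiAnbd2006, Rmk 5.3.1, p. 65] -/
theorem finite_image_quotient_comap {P : Type u''} [Group P] (aug : G →* P) (U : Subgroup P)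
    [Finite (P ⧸ U)] (S : Set G) :
    ((QuotientGroup.mk : G → G ⧸ U.comap aug) '' S).Finite := by
  classical
  let f : G ⧸ U.comap aug → P ⧸ U := fun q =>
    Quotient.map' aug (fun a b h => by
      rw [QuotientGroup.leftRel_apply] at h ⊢
      simpa using h) q
  have hf : Function.Injective f := by
    rintro ⟨a⟩ ⟨b⟩ h
    change (QuotientGroup.mk (aug a) : P ⧸ U) = QuotientGroup.mk (aug b) at h
    change (QuotientGroup.mk a : G ⧸ U.comap aug) = QuotientGroup.mk b
    rw [QuotientGroup.eq] at h ⊢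
    simpa using h
  exact Set.Finite.of_finite_image (Set.toFinite _) hf.injOn

end Tempered

/-! ### Stabilisers of vertex systems are closed -/

section Stabilizer

variable {G : Type u'} [Group G] [TopologicalSpace G] [IsTopologicalGroup G]

/-- The stabiliser of a tree vertex under an action `act : G →* Aut T` with OPEN KERNEL is an open,
hence closed, subgroup (it is a union of cosets of the kernel). [cite: MochizukiSemiAnbd2006, Thm 3.7 (iii), p. 41] -/
theorem isClosed_setOf_vertexMap_eq {T : SemiGraph.{u}} (act : G →* Aut T)
    (hopen : IsOpen (act.ker : Set G)) (x : T.Vertex) :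
    IsClosed {g : G | (act g).hom.vertexMap x = x} := by
  -- the stabiliser as a subgroup
  let S : Subgroup G :=
    { carrier := {g : G | (act g).hom.vertexMap x = x}
      one_mem' := by
        simp only [Set.mem_setOf_eq, map_one]
        rfl
      mul_mem' := by
        intro a b ha hb
        simp only [Set.mem_setOf_eq] at ha hb ⊢
        rw [map_mul, Aut.Aut_mul_def, Iso.trans_hom, SemiGraph.comp_vertexMap, Function.comp_apply,
          hb, ha]
      inv_mem' := by
        intro a ha
        simp only [Set.mem_setOf_eq] at ha ⊢
        have h : ((act a).hom ≫ (act a).inv).vertexMap x = x := by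
          rw [Iso.hom_inv_id]
          rfl
        rw [SemiGraph.comp_vertexMap, Function.comp_apply, ha] at h
        rw [map_inv, Aut.Aut_inv_def]
        exact h }
  have hle : act.ker ≤ S := by
    intro g hg
    rw [MonoidHom.mem_ker] at hg
    change (act g).hom.vertexMap x = x
    rw [hg]
    rfl
  have hSopen : IsOpen (S : Set G) := Subgroup.isOpen_mono hle hopen
  exact Subgroup.isClosed_of_isOpen S hSopen

/-- The stabiliser `{g | ∀ j, g • x_j = x_j}` of a SYSTEM of tree vertices under actions with open
kernels is closed. [cite: MochizukiSemiAnbd2006, Thm 3.7 (iii), p. 41] -/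
theorem isClosed_setOf_forall_vertexMap_eq {J : Type*} {T : J → SemiGraph.{u}}
    (act : ∀ j, G →* Aut (T j)) (hopen : ∀ j, IsOpen ((act j).ker : Set G))
    (x : ∀ j, (T j).Vertex) :
    IsClosed {g : G | ∀ j, (act j g).hom.vertexMap (x j) = x j} := by
  have : {g : G | ∀ j, (act j g).hom.vertexMap (x j) = x j} =
      ⋂ j, {g : G | (act j g).hom.vertexMap (x j) = x j} := by
    ext g; simp
  rw [this]
  exact isClosed_iInter fun j => isClosed_setOf_vertexMap_eq (act j) (hopen j) (x j)

/-- **Compact stabilisers of pro-vertices** ([SemiAnbd] p. 41 / p. 65: decomposition groups are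
compact): in a tempered group acting on trees `T_j` through homomorphisms with open kernels, the
stabiliser of a system of vertices `(x_j)` is compact as soon as its image in every `G/N` is finite
(at each level the vertex stabilisers of the discrete Galois group acting on the tree are finite).
[cite: MochizukiSemiAnbd2006, Rmk 5.3.1, p. 65] -/
theorem IsTempered.isCompact_setOf_forall_vertexMap_eq (hG : IsTempered G) {J : Type*}
    {T : J → SemiGraph.{u}} (act : ∀ j, G →* Aut (T j)) (hopen : ∀ j, IsOpen ((act j).ker : Set G))
    (x : ∀ j, (T j).Vertex)
    (hfin : ∀ N : OpenNormalSubgroup G, ((QuotientGroup.mk : G → G ⧸ N.toSubgroup) ''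
      {g : G | ∀ j, (act j g).hom.vertexMap (x j) = x j}).Finite) :
    IsCompact {g : G | ∀ j, (act j g).hom.vertexMap (x j) = x j} :=
  hG.isCompact_of_isClosed_of_finite_image (isClosed_setOf_forall_vertexMap_eq act hopen x) hfin

end Stabilizer

/-! ### `hVc` / `hBc` for the chart-produced data, in tower currency -/

namespace ProfiniteSemiGraph

variable {𝒢 : ProfiniteSemiGraph.{u}} {c : TemperedPiChart 𝒢}
  {Gtp : Type u'} [Group Gtp] [TopologicalSpace Gtp] [IsTopologicalGroup Gtp]

/-- **`hVc` in tower currency** ([SemiAnbd] p. 65: `Π^temp_{𝔊,v}` is compact): for the chart-produced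
data, if `Π^temp_𝔊` is tempered (abc-iut-L3-d2), the arithmetic actions on the trees `𝒢_{∞,j}` have
open kernels, the (AI1) dictionary identifies `Π^temp_{𝔊,v} = arithVertGp R ι v` with the stabiliser
of a pro-vertex `(x_j)` (abc-iut-w4-d059's `mem_arithVertGp_iff_fixes_of_edgeData`), and the image
of `Π^temp_{𝔊,v}` in every discrete quotient of `Π^temp_𝔊` is finite (finite vertex stabilisers at
each arithmetic level), then `Π^temp_{𝔊,v}` is compact. [cite: MochizukiSemiAnbd2006, Rmk 5.3.1, p. 65] -/
theorem isCompact_arithVertGp_of_forall_fixes (hG : IsTempered Gtp) (R : ChartRepresentatives c)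
    (ι : c.G →* Gtp) {J : Type*} {T : J → SemiGraph.{u}} (act : ∀ j, Gtp →* Aut (T j))
    (hopen : ∀ j, IsOpen ((act j).ker : Set Gtp)) (v : 𝒢.graph.Vertex) (x : ∀ j, (T j).Vertex)
    (hdict : ∀ g : Gtp, g ∈ arithVertGp R ι v ↔ ∀ j, (act j g).hom.vertexMap (x j) = x j)
    (hfin : ∀ N : OpenNormalSubgroup Gtp,
      ((QuotientGroup.mk : Gtp → Gtp ⧸ N.toSubgroup) '' (arithVertGp R ι v : Set Gtp)).Finite) :
    IsCompact (arithVertGp R ι v : Set Gtp) := by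
  have hset : (arithVertGp R ι v : Set Gtp) = {g : Gtp | ∀ j, (act j g).hom.vertexMap (x j) = x j} := by
    ext g; exact hdict g
  rw [hset] at hfin ⊢
  exact hG.isCompact_setOf_forall_vertexMap_eq act hopen x hfin

/-- `hVc`, closedness-only form: a CLOSED `Π^temp_{𝔊,v}` with finite images in all discrete quotients
of the tempered `Π^temp_𝔊` is compact (the dictionary is only used to see closedness).
[cite: MochizukiSemiAnbd2006, Rmk 5.3.1, p. 65] -/
theorem isCompact_arithVertGp_of_isClosed (hG : IsTempered Gtp) (R : ChartRepresentatives c)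
    (ι : c.G →* Gtp) (v : 𝒢.graph.Vertex) (hclosed : IsClosed (arithVertGp R ι v : Set Gtp))
    (hfin : ∀ N : OpenNormalSubgroup Gtp,
      ((QuotientGroup.mk : Gtp → Gtp ⧸ N.toSubgroup) '' (arithVertGp R ι v : Set Gtp)).Finite) :
    IsCompact (arithVertGp R ι v : Set Gtp) :=
  hG.isCompact_of_isClosed_of_finite_image hclosed hfin

omit [IsTopologicalGroup Gtp] in
/-- **`hBc` in tower currency** ([SemiAnbd] p. 65: `Π^temp_{𝔊,b} ⊆ Π^temp_{𝔊,v}`): the branch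
decomposition group `arithBrGp R ι b ≤ arithVertGp R ι v` (`arithBrGp_le_arithVertGp`, for `b`
abutting to `v`) is compact as soon as it is closed and `arithVertGp R ι v` is compact — closedness
holds e.g. when it is a pair-stabiliser (abc-iut-w4-d059's `mem_arithBrGp_iff_fixes_pair`, with
`isClosed_setOf_forall_vertexMap_eq`). [cite: MochizukiSemiAnbd2006, Rmk 5.3.1, p. 65] -/
theorem isCompact_arithBrGp_of_isClosed (R : ChartRepresentatives c) (ι : c.G →* Gtp)
    {b : 𝒢.graph.Branch} {v : 𝒢.graph.Vertex} (hb : 𝒢.graph.abuts b = some v)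
    (hVc : IsCompact (arithVertGp R ι v : Set Gtp)) (hclosed : IsClosed (arithBrGp R ι b : Set Gtp)) :
    IsCompact (arithBrGp R ι b : Set Gtp) :=
  hVc.of_isClosed_subset hclosed (fun _ hg => arithBrGp_le_arithVertGp R ι hb hg)

/-- `hBc` from the pair dictionary: if `g ∈ arithBrGp R ι b` iff `g` fixes the two pro-vertices
`(x_j)`, `(y_j)` (abc-iut-w4-d059's `mem_arithBrGp_iff_fixes_pair`), the arithmetic tree actions have
open kernels, and `arithVertGp R ι v` (for `b` abutting to `v`) is compact, then `arithBrGp R ι b`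
is compact. [cite: MochizukiSemiAnbd2006, Rmk 5.3.1, p. 65] -/
theorem isCompact_arithBrGp_of_fixes_pair (R : ChartRepresentatives c) (ι : c.G →* Gtp)
    {J : Type*} {T : J → SemiGraph.{u}} (act : ∀ j, Gtp →* Aut (T j))
    (hopen : ∀ j, IsOpen ((act j).ker : Set Gtp)) {b : 𝒢.graph.Branch} {v : 𝒢.graph.Vertex}
    (hb : 𝒢.graph.abuts b = some v) (x y : ∀ j, (T j).Vertex)
    (hdict : ∀ g : Gtp, g ∈ arithBrGp R ι b ↔
      (∀ j, (act j g).hom.vertexMap (x j) = x j) ∧ ∀ j, (act j g).hom.vertexMap (y j) = y j)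
    (hVc : IsCompact (arithVertGp R ι v : Set Gtp)) :
    IsCompact (arithBrGp R ι b : Set Gtp) := by
  refine isCompact_arithBrGp_of_isClosed R ι hb hVc ?_
  have hset : (arithBrGp R ι b : Set Gtp) =
      {g : Gtp | ∀ j, (act j g).hom.vertexMap (x j) = x j} ∩
        {g : Gtp | ∀ j, (act j g).hom.vertexMap (y j) = y j} := by
    ext g; exact hdict g
  rw [hset]
  exact (isClosed_setOf_forall_vertexMap_eq act hopen x).inter
    (isClosed_setOf_forall_vertexMap_eq act hopen y)

end ProfiniteSemiGraph

end Literature.AnabelianGeometry.SemiGraphs
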